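import Summits.BirchSwinnertonDyer.Rank1Residual.X2.SplitHalvesOnTree
import Summits.BirchSwinnertonDyer.Rank1Residual.X2.NonsplitControlLinks
import Summits.BirchSwinnertonDyer.Rank1Residual.X2.NonsplitHalvesOnTree
import HarnessLib

/-!
# O9 ∩ {SPLIT}: the ONE construction-class atom `SplitControlOnTree W p` (Castella's control theorem at
# `𝟙` = the tree's EXISTING shape `X11b.ControlOnTreeAt`, at a split Eisenstein `p ‖ N`, torsion
# allowed) and the ASSEMBLY of the split half of crux 4 `BSDpOnCellC` at a Heegner datum: `BSD(E,p)`
# from print + c1s + c2s + c3s + CTL-split + the partner (cell `bsd-eis`, seat `bsd-eis-cgshw` g6;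
# memo `cgshw-MEMO-7.md` §§1–2, §8(1); route `EisensteinPrimes`, line b1, stub `stub_split`)

HONEST FRAMING (cell `bsd-eis`): one `@[conjecture]`-tagged hypothesis-shaped predicate and theorems;
nothing asserted; nothing booked; X2 stays CONSTRUCTION-SHAPED; no label moves. MEMO-7 §1 (read off
the tree): on the non-split O9 road the hypothesis «¬ split» is consumed in exactly ONE place, the
control theorem `controlOnTreeAt_of_cellC_of_not_split` (p398508); `R1.imcWaldspurgerOnTreeAt_of_halves`
(CTL₀ ∧ H3 ∧ H2 ⟹ (IMC∘BDP)@𝟙; `a_p = ±1` both prime to `p`), `exists_shadowLinks_of_onTree_of_heegner`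
and `bsdp_of_cellC_of_indexIdentityAt` (JSW §7.4.1 descent `K → ℚ`, torsion included) are sign-free
as typed. Hence:

* **`SplitControlOnTree W p`** — `ControlOnTreeAt p κ 𝔭 γ (embAt K p 𝔭) P` at every CGLS datum of a
  split CellC pair (MEMO-7 §2: the torsion-allowing exact control of Keller–Yin App. B evaluates to
  THIS shape — local torsion cancels, global torsion is the full index); NOT in print at a split
  Eisenstein `p ‖ N`; proof obligations (I1)–(I6) in MEMO-7 §2c. The split twin of a tree THEOREM.
* **`bsdp_of_cellC_of_controlOnTreeAt_of_halves_of_partner`** — SIGN-FREE pointwise assembly: at a CGLS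
  Heegner datum of ANY CellC pair, `BSD(E,p)` from GZK/modularity/GZ/Kolyvagin (PUB), the control
  input `ControlOnTreeAt` AT THE DATUM (hypothesis), a frame `L` with H3 `R1.IMCEqOnTreeAt` and H2
  `R1.BDPValueAtOneOnTreeAt … (a_p)`, and the partner's `PPartRankZero Wd p` — p398550's
  `bsdp_of_cellC_of_not_split_of_imcWaldspurgerOnTree_of_partner` ∘ p403688's halves step with `hns`
  REMOVED (the five cited cohomological facts are not needed once (CTL) is a hypothesis).
* **`bsdp_of_cellC_of_split_of_hsieh2014_of_halvesOnTree_of_partner`** — the split twin of p404431's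
  either-parity theorem: Hsieh 2014 Thm. 1 (`hH`, PUB) + c1s `SplitHsiehFrameResidualAt` PRODUCE the
  frame (`exists_isBDPLFunction_of_hsieh2014_of_split`), c2s/c3s are instantiated at it, CTL-split at
  the datum, and the sign-free assembly concludes; partner `PPartRankZero Wd p` explicit (`Wd ∼ E^{d_K}`
  is a rank-`0` X2 pair, SPLIT at `p` — `hasSplitMultiplicativeReductionAtPrime_iff_of_smul_eq_quadraticTwist`).
* **`bsdp_of_cellC_of_split_of_hsieh2014_of_halvesOnTree_of_mazurMainConjectureAt`** — the same with the
  partner's input in main-conjecture form `X2.MazurMainConjectureAt Wd p` (Mazur's MC at a SPLIT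
  Eisenstein `p ‖ N` for the twist: crux 3 ∩ split, row A10-split's object) through
  `bsdp_of_mazurMainConjectureAt_of_analyticRank_eq_zero` (needed only when `Wd` lacks the GV parity).

So on O9 ∩ {split} (≈ 6 990 classes incl. every `p ∣ #E(ℚ)_tors` cell) the residual inputs are NAMED:
{Hsieh 2014 Thm. 1 (PUB), c1s, c2s (PUB shape `p ≥ 5`), c3s (KY §5.1 shape, PRE), CTL-split (NOT in
print)} + the partner's rank-zero MC at a split `p` (or X2a). CONDITIONAL on every listed binder.

References: [Castella2018] Thm. 2.3, 3.2, §5; [JetchevSkinnerWan2017] Thm. 3.3.1, Prop. 3.3.7, §7.4.1;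
[KellerYin2024] §5.1, App. B (PRE); [GreenbergLNM1716] §4; [Hsieh2014] Thm. 1; [CastellaEtAl2021]
Thm. 5.3.1; [SteinWuthrich2013] Thm. 6.1; [Miller2011LMS] Def. 1.1.
-/

set_option autoImplicit false

noncomputable section

open scoped Classical MatrixGroups ModularForm

open CongruenceSubgroup WeierstrassCurve NumberField IsDedekindDomain Field PowerSeries
  Literature.NumberTheory.EllipticCurves Literature.NumberTheory.EllipticCurves.GreenbergSelmer
  Literature.NumberTheory.EllipticCurves.ModularForms
  Literature.NumberTheory.EllipticCurves.Rank1Residual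
  Literature.NumberTheory.EllipticCurves.Rank1Residual.Typed
  Literature.NumberTheory.EllipticCurves.GreenbergVatsal2000
  Literature.NumberTheory.EllipticCurves.Wuthrich2014
  Literature.NumberTheory.EllipticCurves.SteinWuthrich2013
  Literature.NumberTheory.GaloisRepresentations Literature.NumberTheory.GaloisCohomology
  Literature.NumberTheory.Automorphic
  Summit.BirchSwinnertonDyer.Rank1Residual.X11b.AcSelmer
  Summit.BirchSwinnertonDyer.Rank1Residual.X11b.Halves
  Summit.BirchSwinnertonDyer.Rank1Residual.X11b

namespace Summit.BirchSwinnertonDyer.Rank1Residual.X2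

/-! ### The construction-class atom of the split road: (CTL) at `𝟙`, torsion allowed, EXISTING shape -/

section Control

variable (W : WeierstrassCurve ℚ) [W.IsElliptic] [W.IsGloballyMinimal] (p : ℕ) [Fact p.Prime]

/-- **CTL-split — `SplitControlOnTree W p`: Castella's anticyclotomic control theorem at `𝟙` (Cas18
Thm. 2.3 / JSW17 Thm. 3.3.1 SHAPE on the tree's constructed `X_ac`, i.e. `X11b.ControlOnTreeAt`) at
every CGLS datum of an X2c pair at a SPLIT `p ‖ N` — THE construction-class atom of the split road.**
For `W/ℚ` globally minimal, `CellC W p` (analytic rank one, `p ≠ 2`, `E[p]` reducible, `p`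
multiplicative), `p` SPLIT multiplicative, `K` imaginary quadratic with `p` split
(`SatisfiesHeegnerHypothesis p K`) and `L(E^{(d_K)},1) ≠ 0`, a non-torsion `P ∈ E(K)`, an
anticyclotomic `κ` with topological generator `γ`, a degree-one `𝔭 ∋ p`: `ControlOnTreeAt p κ 𝔭 γ
(embAt K p 𝔭) P`, i.e. `X_ac^∅(E[p^∞])` is torsion with a generator `f`, `f(0) ≠ 0`, and
`ord_p f(0) = ord_p #Ш(E/K)[p^∞] + 2·((ord_p log_ω P − 1) − ord_p [E(K) : ℤP]) + ord_p ∏_{w∣N} c_w(E/K)`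
with the FULL index `[E(K) : ℤP]` (`AddSubgroup.index` of `ℤP` in `E(K)`, torsion included). WHY THE
SAME SHAPE AS AT A NON-SPLIT `p` (where it is the THEOREM `controlOnTreeAt_of_cellC_of_not_split`,
p398508, every torsion input being free since `E(ℚ_p)[p] = 0`): at a split `p` both `E(K)[p]` (type-A
cells, `p ∣ #E(ℚ)_tors`) and `E(ℚ_p)[p]` (`q_E ∈ (ℚ_p^×)^p`) may be non-zero, and the torsion-allowing
exact control at `𝟙` is Keller–Yin v2 App. B Thm. B.0.2 «#𝒪/f(0) = #H¹_{F_ac}(K,W)·C^Σ(W)/(#H⁰(K,W)·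
#H⁰(K,W)^∨)», `C^∅(W) = #H⁰(K_v,W)·#H⁰(K_v̄,W)·∏_w #H¹_nr(K_w,W)`, with §B.3 «the index becomes
[E(K)_{/tors} : ℤ·P]_p … E(K)_tors has already been considered separately» and Castella CJM 2018's
`p ∣ N` local index «[E(K_𝔭)_{/tors}⊗ℤ_p : ℤ_p.P] = [E(K_𝔭):E_0(K_𝔭)]_p·#ℤ_p/(p⁻¹log_{ω_E}P)/
#H⁰(K_𝔭,E[p^∞])»; for `E/ℚ` (`K_v ≅ K_v̄ ≅ ℚ_p`) the local torsion `#E(ℚ_p)[p^∞]` CANCELS between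
`C^∅(W)` and `(#δ_v)²`, and `[E(K)_{/tors}:ℤP]·#E(K)[p^∞] = [E(K):ℤP]` (`ℤP ∩ E(K)_tors = 0` for `P`
of infinite order) — MEMO-7 §2a; the shape is FORCED, since with (IMC) + (BDP) it is the `p`-part of
GZ–BSD over `K`, `#Ш(E/K)∏c_v = ([E(K):ℤP_K]/(c·u_K))²` (MEMO-7 §2b). PRINT STATUS: NOT in print as a
statement with proof at a split Eisenstein `p ‖ N` (LIT-DOSSIER §32 ANSWER (1)): Cas18 Thm. 2.3's
STATEMENT (PUB) has no torsion / image / sign hypothesis and includes `p ∣ N`, but its proof is JSW17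
Thm. 3.3.1 under (irred_K); KY App. B (PRE) allows torsion but its inputs (`surj for Self`,
`corankH1Mf`, `Lambda invariants`, `H0 of V/T`) are proved in KY §1 under «p ∤ N»; JSW17 Prop. 3.3.7
Case 3(b)(ii) (semistable non-crystalline `v`, either sign) supplies the local finiteness. Proof
obligations at a split `p` itemised in MEMO-7 §2c (I1)–(I6): `E(K_∞^{ac})[p^∞]` finite; `#ker h =
#E(K)[p^∞]`; surjectivity of the global-to-local map over `K_∞`; Cassels–Poitou–Tate `𝒫/𝒢 ≅
H⁰(K,W)^∨`; `#ker r_v·#ker r_v̄ = #H⁰(K_v,W)²` and `#Sel_ac(K,W) = #Ш·(#δ_v)²` with the torsion-quotient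
index; the coinvariant term. NO exceptional-zero / `(γ−1)²` identity and NO ℒ-invariant belong to this
statement (those concern the Greenberg Selmer group and the TRUE-Selmer tower control Castella 2024
Thm. 3.4; LIT-DOSSIER §32 (B)/(C)). A predicate on `(W, p)`; TYPED, not attempted; nothing asserted;
consumed as a hypothesis; the split twin of a tree THEOREM.
[cite: Castella2018, Thm. 2.3 and its proof (arXiv:1704.06608 pp. 5–6) (statement incl. p ∣ N; shape only)]
[cite: JetchevSkinnerWan2017, Thm. 3.3.1, Prop. 3.2.1 with Rem. 3.2.2, Prop. 3.3.7 Case 3 (arXiv:1512.06894 pp. 10–13)]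
[claim: KellerYin2024, status: under-review]
[cite: GreenbergLNM1716, §4 Lemma 4.2, Prop. 4.13 (pp. 98–104) (the architecture)] -/
@[conjecture]
def SplitControlOnTree : Prop :=
  ∀ (K : Type) [Field K] [NumberField K] (P : (W.baseChange K).toAffine.Point),
    CellC W p → W.HasSplitMultiplicativeReductionAtPrime p →
    IsImaginaryQuadratic K → SatisfiesHeegnerHypothesis p K →
    (W.quadraticTwist (NumberField.discr K : ℚ)).entireLFunction 1 ≠ 0 → ¬ IsOfFinAddOrder P →
    ∀ (κ : ZpExtension K p), κ.IsAnticyclotomic →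
      ∀ (γ : Field.absoluteGaloisGroup K) [Fact (κ.IsTopGenerator γ)]
        (𝔭 : HeightOneSpectrum (𝓞 K)) (h𝔭 : ((p : ℕ) : 𝓞 K) ∈ 𝔭.asIdeal)
        (he : 𝔭.asIdeal.ramificationIdx (𝓞 ℚ) = 1) (hf : 𝔭.asIdeal.inertiaDeg (𝓞 ℚ) = 1),
        ControlOnTreeAt p κ 𝔭 γ (embAt K p 𝔭 h𝔭 he hf) P

end Control

/-! ### SIGN-FREE pointwise assembly with (CTL) as a hypothesis -/

section Assembly

variable (W : WeierstrassCurve ℚ) [W.IsElliptic] [W.IsGloballyMinimal] (p : ℕ) [Fact p.Prime]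

/-- **ANY sign: `BSD(E,p)` at a CGLS Heegner datum of a CellC pair FROM the control input AT THE DATUM,
the two halves at SOME frame, the partner's rank-zero `p`-part, and PUBLISHED facts** — p398550's
`bsdp_of_cellC_of_not_split_of_imcWaldspurgerOnTree_of_partner` composed with the halves step of
p403688, with the hypothesis `hns` REMOVED: the only use of «¬ split» there was to PROVE `ControlOnTreeAt`
(`controlOnTreeAt_of_cellC_of_not_split`); here (CTL) is the hypothesis `hCTL` (at a non-split `p` a
theorem; at a split `p` the typed atom `SplitControlOnTree`). Chain: `hCTL` gives `n` with
`X_ac.HasCharValuationAt n`; H3 ∧ H2 ∧ `p ∤ a_p(E)` (`R1.not_dvd_lFunction_of_mult`, `a_p = ±1`) give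
(IMC∘BDP)@`𝟙` (`R1.imcWaldspurgerOnTreeAt_of_halves`); with `hCTL` again, the four shadow links at a
Heegner field (`exists_shadowLinks_of_onTree_of_heegner`, (TAM) exact); the Heegner-index identity
(`indexIdentityAt_of_shadowLinks`); the descent `K → ℚ` (`bsdp_of_cellC_of_indexIdentityAt`, torsion
included, every odd `p`). Data: `K` imaginary quadratic, `d_K < −4`, Heegner hypothesis for the level
`N = N_E` of `Dt` (`p ∤ c`), `P` its Heegner point (for (BDP)) — non-torsion —, `L(E^{d_K},1) ≠ 0`, a
globally minimal `Wd = Cd • E^{(d_K)}` with `htam`, `hu`, `htamK`, anticyclotomic `(κ, γ)`, degree-one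
`𝔭 ∋ p`. Binders: `hnf`, `hGZ`, `hKo`, `hGZK` (PUB), `hCTL`, `h3` (OPEN shape), `h2` (PUB shape at
`p ≥ 5`), `htw`. NO cited cohomological fact is needed here. CONDITIONAL; nothing booked.
[cite: Castella2018, Thm. 2.3, Thm. 3.2 and §5 (5.1)–(5.3) (arXiv:1704.06608 pp. 5, 9, 12)]
[cite: JetchevSkinnerWan2017, §7.4.1 (eq:gz for K′), p. 30] [cite: CastellaEtAl2021, Thm. 5.3.1]
[cite: Miller2011LMS, Def. 1.1] -/
theorem bsdp_of_cellC_of_controlOnTreeAt_of_halves_of_partner (hnf : exists_isNewformOf)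
    (N : ℕ) [NeZero N] (K : Type) [Field K] [NumberField K]
    (Dt : ModularParametrizationData W N) (H : HeegnerDatum N (NumberField.discr K)) (ι : K →+* ℂ)
    (P : (W.baseChange K).toAffine.Point)
    (hGZ : gross_zagier N W K) (hKo : kolyvagin N W K)
    (hGZK : rank_eq_analyticRank_of_analyticRank_le_one)
    (hc : CellC W p) (hN : W.conductorNorm ℤ = N) (hK : IsImaginaryQuadratic K)
    (hd4 : NumberField.discr K < -4) (hHN : SatisfiesHeegnerHypothesis N K)
    (hP : WeierstrassCurve.Affine.Point.map ι.toRatAlgHom P = heegnerPointComplex Dt H)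
    (hcM : ¬ (p : ℤ) ∣ Dt.c)
    (hLt : (W.quadraticTwist (NumberField.discr K : ℚ)).entireLFunction 1 ≠ 0)
    (Wd : WeierstrassCurve ℚ) [Wd.IsElliptic] [Wd.IsGloballyMinimal] (Cd : VariableChange ℚ)
    (hWd : Cd • W.quadraticTwist (NumberField.discr K : ℚ) = Wd) (htw : PPartRankZero Wd p)
    (htam : padicValNat p Wd.tamagawaProduct = padicValNat p W.tamagawaProduct)
    (hu : padicValRat p (Cd.u : ℚ) = 0)
    (htamK : padicValNat p (W.baseChange K).tamagawaProduct = 2 * padicValNat p W.tamagawaProduct)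
    (κ : ZpExtension K p) (𝔭 : HeightOneSpectrum (𝓞 K)) (γ : absoluteGaloisGroup K)
    [Fact (κ.IsTopGenerator γ)] (h𝔭 : ((p : ℕ) : 𝓞 K) ∈ 𝔭.asIdeal)
    (he : 𝔭.asIdeal.ramificationIdx (𝓞 ℚ) = 1) (hf : 𝔭.asIdeal.inertiaDeg (𝓞 ℚ) = 1)
    (hCTL : ControlOnTreeAt p κ 𝔭 γ (embAt K p 𝔭 h𝔭 he hf) P) (L : UnrSeries p)
    (h3 : R1.IMCEqOnTreeAt W p κ 𝔭 γ L)
    (h2 : R1.BDPValueAtOneOnTreeAt W p (embAt K p 𝔭 h𝔭 he hf) P L (W.LFunction p)) : BSDp W p := by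
  have hmod : hasEntireLFunction_rat := hasEntireLFunction_rat_of_exists_isNewformOf hnf
  haveI : NeZero (W.conductorNorm ℤ) := ⟨(W.conductorNorm_pos_holds).ne'⟩
  obtain ⟨f, hfW⟩ := hnf W
  obtain ⟨n, hn, hne⟩ := hCTL
  have hIW : IMCWaldspurgerOnTreeAt p κ 𝔭 γ (embAt K p 𝔭 h𝔭 he hf) P :=
    R1.imcWaldspurgerOnTreeAt_of_halves hn h3 (R1.not_dvd_lFunction_of_mult hfW hc.2.2.2) h2
  obtain ⟨S, hIMC, hBDP, hCTL', hTAM⟩ :=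
    exists_shadowLinks_of_onTree_of_heegner p κ 𝔭 γ (embAt K p 𝔭 h𝔭 he hf) hN hHN hIW ⟨n, hn, hne⟩
  exact bsdp_of_cellC_of_indexIdentityAt W p N K Dt H ι P hGZ hKo hGZK hmod hc hK hd4 hHN hP hcM hLt
    Wd Cd hWd htw htam hu
    (fun hfin => by
      haveI := hfin
      exact indexIdentityAt_of_shadowLinks p S hIMC hBDP hCTL' hTAM htamK)

/-- **O9 ∩ {SPLIT} at a Heegner datum FROM PRINT + c1s + c2s + c3s + CTL-split + the partner's
rank-zero `p`-part** — the split twin of p404431's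
`bsdp_of_cellC_of_not_split_of_hsieh2014_of_halvesOnTree_of_partner`. For a rank-one X2 pair at a SPLIT
`p`: the frame is PRODUCED — `ι₀ : ℚ̄_p ≃ ℂ` (Steinitz, `PadicAlgCl.nonempty_ringEquiv_complex`), the
degree-one `𝔭` is induced by `ι₀` or `ι₀ ∘ conj` (`X11b.exists_datum_forall_mem_iff`), Hsieh 2014
Thm. 1 (`hH`, PUB) + c1s (`hres`) + the glue give `(Ω_K, Ω_p, L)` there
(`exists_isBDPLFunction_of_hsieh2014_of_split`), c2s (`h2`) / c3s (`h3`) are instantiated at it,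
CTL-split (`hCTL`) at the datum, and `bsdp_of_cellC_of_controlOnTreeAt_of_halves_of_partner` concludes.
The partner's `PPartRankZero Wd p` stays explicit (`Wd ∼ E^{(d_K)}`: rank `0`, X2, SPLIT at `p` —
X2a-closed when it has the GV parity; otherwise Mazur's MC at a split Eisenstein `p ‖ N`, crux 3 ∩
split). CONDITIONAL on every listed binder; nothing booked; no label change.
[cite: Hsieh2014, Thm. 1 (arXiv:1112.1580 pp. 3–4)] [claim: KellerYin2024, status: under-review]
[cite: Castella2018Exceptional, Thm. 2.11 (arXiv:1507.04260 p. 14)] [cite: Castella2018, Thm. 2.3, Thm. 3.2 and §5 (arXiv:1704.06608 pp. 5, 9, 12)]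
[cite: Miller2011LMS, Def. 1.1] -/
theorem bsdp_of_cellC_of_split_of_hsieh2014_of_halvesOnTree_of_partner
    (hnf : exists_isNewformOf) (hH : hsieh2014_exists_anticyclotomicPAdicLFunction)
    (N : ℕ) [NeZero N] (K : Type) [Field K] [NumberField K]
    (Dt : ModularParametrizationData W N) (H : HeegnerDatum N (NumberField.discr K)) (ι : K →+* ℂ)
    (P : (W.baseChange K).toAffine.Point)
    (hGZ : gross_zagier N W K) (hKo : kolyvagin N W K)
    (hGZK : rank_eq_analyticRank_of_analyticRank_le_one)
    (hc : CellC W p) (hs : W.HasSplitMultiplicativeReductionAtPrime p) (hN : W.conductorNorm ℤ = N)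
    (hK : IsImaginaryQuadratic K) (hd4 : NumberField.discr K < -4)
    (hHN : SatisfiesHeegnerHypothesis N K) (hsplit : SatisfiesHeegnerHypothesis p K)
    (hP : WeierstrassCurve.Affine.Point.map ι.toRatAlgHom P = heegnerPointComplex Dt H)
    (hPinf : ¬ IsOfFinAddOrder P) (hcM : ¬ (p : ℤ) ∣ Dt.c)
    (hLt : (W.quadraticTwist (NumberField.discr K : ℚ)).entireLFunction 1 ≠ 0)
    (Wd : WeierstrassCurve ℚ) [Wd.IsElliptic] [Wd.IsGloballyMinimal] (Cd : VariableChange ℚ)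
    (hWd : Cd • W.quadraticTwist (NumberField.discr K : ℚ) = Wd) (htw : PPartRankZero Wd p)
    (htam : padicValNat p Wd.tamagawaProduct = padicValNat p W.tamagawaProduct)
    (hu : padicValRat p (Cd.u : ℚ) = 0)
    (htamK : padicValNat p (W.baseChange K).tamagawaProduct = 2 * padicValNat p W.tamagawaProduct)
    (κ : ZpExtension K p) (hκ : κ.IsAnticyclotomic) (γ : absoluteGaloisGroup K)
    [Fact (κ.IsTopGenerator γ)] (𝔭 : HeightOneSpectrum (𝓞 K))
    (h𝔭 : ((p : ℕ) : 𝓞 K) ∈ 𝔭.asIdeal) (he : 𝔭.asIdeal.ramificationIdx (𝓞 ℚ) = 1)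
    (hf : 𝔭.asIdeal.inertiaDeg (𝓞 ℚ) = 1)
    (hres : SplitHsiehFrameResidualAt W p) (h2 : SplitBDPValueOnTree W p)
    (h3 : SplitIMCEqOnTree W p) (hCTL : SplitControlOnTree W p) : BSDp W p := by
  subst hN
  obtain ⟨f, hfW⟩ := hnf W
  obtain ⟨ι₀⟩ := PadicAlgCl.nonempty_ringEquiv_complex p
  obtain ⟨ι', -, hι'⟩ := X11b.exists_datum_forall_mem_iff p ι₀ hK h𝔭
  obtain ⟨ΩK, Ωp, L, hΩK, hL⟩ := exists_isBDPLFunction_of_hsieh2014_of_split W p hH hres ι' 𝔭 κ γ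
    hfW hc.2 hs rfl hK hHN h𝔭 he hf hι' hκ Fact.out
  exact bsdp_of_cellC_of_controlOnTreeAt_of_halves_of_partner W p hnf (W.conductorNorm ℤ) K Dt H ι P
    hGZ hKo hGZK hc rfl hK hd4 hHN hP hcM hLt Wd Cd hWd htw htam hu htamK κ 𝔭 γ h𝔭 he hf
    (hCTL K P hc hs hK hsplit hLt hPinf κ hκ γ 𝔭 h𝔭 he hf) L
    (h3 (W.conductorNorm ℤ) K Dt H ι P hc hs rfl hK hd4 hHN hLt hP hcM hPinf κ hκ γ 𝔭 h𝔭 he hf f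
      hfW ι' hι' ΩK Ωp L hΩK hL)
    (h2 (W.conductorNorm ℤ) K Dt H ι P hc hs rfl hK hd4 hHN hLt hP hcM hPinf κ hκ γ 𝔭 h𝔭 he hf f
      hfW ι' hι' ΩK Ωp L hΩK hL)

/-- **The same with the partner's input in MAIN-CONJECTURE form**: `PPartRankZero Wd p` DERIVED from
**`X2.MazurMainConjectureAt Wd p`** — Mazur's main conjecture at the SPLIT Eisenstein prime `p ‖ N` for
the CGLS twist `E^{d_K}` (rank `0`, X2 by `classX2_twist`, split at `p`: crux 3 ∩ split, row A10-split;
needed only when `Wd` lacks the Greenberg–Vatsal parity, else X2a's `pPartRankZero_twist_of_not_gvPar`)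
— through the published rank-zero closer `bsdp_of_mazurMainConjectureAt_of_analyticRank_eq_zero`
(`X2/RankZero.lean`: Stein–Wuthrich 6.1, canonical heights, GZK, modularity, Greenberg–Stevens) and
`pPart_of_bsdp` / `pPartRankZero_of_pPart`; the split twin of p404695. CONDITIONAL on every listed
binder; nothing booked; no label change. [cite: CastellaEtAl2021, Thm. 5.3.1 and its proof]
[cite: SteinWuthrich2013, Thm. 6.1] [claim: KellerYin2024, status: under-review] [cite: Miller2011LMS, Def. 1.1] -/
theorem bsdp_of_cellC_of_split_of_hsieh2014_of_halvesOnTree_of_mazurMainConjectureAt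
    (hJs : thm61_splitMultiplicative) (hJn : thm61_nonsplitMultiplicative)
    (hHs : exists_isSplitMultCanonical) (hHn : exists_isMultCanonical)
    (hpar : nonempty_modularParametrizationData)
    (hGS : ∀ (W : WeierstrassCurve ℚ) [W.IsElliptic] [W.IsGloballyMinimal] (p : ℕ) [Fact p.Prime],
      greenberg_stevens (W := W) (p := p))
    (hnf : exists_isNewformOf) (hH : hsieh2014_exists_anticyclotomicPAdicLFunction)
    (N : ℕ) [NeZero N] (K : Type) [Field K] [NumberField K]
    (Dt : ModularParametrizationData W N) (H : HeegnerDatum N (NumberField.discr K)) (ι : K →+* ℂ)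
    (P : (W.baseChange K).toAffine.Point)
    (hGZ : gross_zagier N W K) (hKo : kolyvagin N W K)
    (hGZK : rank_eq_analyticRank_of_analyticRank_le_one)
    (hc : CellC W p) (hs : W.HasSplitMultiplicativeReductionAtPrime p) (hN : W.conductorNorm ℤ = N)
    (hK : IsImaginaryQuadratic K) (hd4 : NumberField.discr K < -4)
    (hHN : SatisfiesHeegnerHypothesis N K) (hsplit : SatisfiesHeegnerHypothesis p K)
    (hP : WeierstrassCurve.Affine.Point.map ι.toRatAlgHom P = heegnerPointComplex Dt H)
    (hPinf : ¬ IsOfFinAddOrder P) (hcM : ¬ (p : ℤ) ∣ Dt.c)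
    (hLt : (W.quadraticTwist (NumberField.discr K : ℚ)).entireLFunction 1 ≠ 0)
    (Wd : WeierstrassCurve ℚ) [Wd.IsElliptic] [Wd.IsGloballyMinimal] (Cd : VariableChange ℚ)
    (hWd : Cd • W.quadraticTwist (NumberField.discr K : ℚ) = Wd)
    (hMC : MazurMainConjectureAt Wd p)
    (htam : padicValNat p Wd.tamagawaProduct = padicValNat p W.tamagawaProduct)
    (hu : padicValRat p (Cd.u : ℚ) = 0)
    (htamK : padicValNat p (W.baseChange K).tamagawaProduct = 2 * padicValNat p W.tamagawaProduct)
    (κ : ZpExtension K p) (hκ : κ.IsAnticyclotomic) (γ : absoluteGaloisGroup K)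
    [Fact (κ.IsTopGenerator γ)] (𝔭 : HeightOneSpectrum (𝓞 K))
    (h𝔭 : ((p : ℕ) : 𝓞 K) ∈ 𝔭.asIdeal) (he : 𝔭.asIdeal.ramificationIdx (𝓞 ℚ) = 1)
    (hf : 𝔭.asIdeal.inertiaDeg (𝓞 ℚ) = 1)
    (hres : SplitHsiehFrameResidualAt W p) (h2 : SplitBDPValueOnTree W p)
    (h3 : SplitIMCEqOnTree W p) (hCTL : SplitControlOnTree W p) : BSDp W p := by
  have hmod : hasEntireLFunction_rat := hasEntireLFunction_rat_of_exists_isNewformOf hnf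
  have hC : Cd⁻¹ • Wd = W.quadraticTwist (NumberField.discr K : ℚ) := by
    rw [← hWd, inv_smul_smul]
  have hXd : ClassX2 Wd p := classX2_twist W p hc.2 K hK hsplit Wd ⟨Cd⁻¹, hC⟩
  have hLd : Wd.entireLFunction 1 ≠ 0 := by
    rw [← Wd.entireLFunction_smul Cd⁻¹, hC]
    exact hLt
  have hrd : Wd.analyticRank = 0 := analyticRank_eq_zero_of_entireLFunction_one_ne_zero hLd
  have htw : PPartRankZero Wd p :=
    pPartRankZero_of_pPart hGZK Wd p hrd
      (pPart_of_bsdp hmod hGZK Wd p (by omega)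
        (bsdp_of_mazurMainConjectureAt_of_analyticRank_eq_zero hJs hJn hHs hHn hGZK hmod hpar Wd p
          (hGS Wd p) hXd.1 hXd.2.2 hrd hMC))
  exact bsdp_of_cellC_of_split_of_hsieh2014_of_halvesOnTree_of_partner W p hnf hH N K Dt H ι P hGZ hKo
    hGZK hc hs hN hK hd4 hHN hsplit hP hPinf hcM hLt Wd Cd hWd htw htam hu htamK κ hκ γ 𝔭 h𝔭 he hf hres
    h2 h3 hCTL

end Assembly

end Summit.BirchSwinnertonDyer.Rank1Residual.X2

end
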